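import Mathlib.Analysis.SpecialFunctions.Pow.NNReal
import Mathlib.RingTheory.Radical.NatInt
import Literature.NumberTheory.DiophantineGeometry.GenEllThm21
import Literature.NumberTheory.DiophantineGeometry.StrongHall
import Literature.NumberTheory.EllipticCurves.Szpiro
import Summits.ABC.ABC.Statement
import HarnessLib

/-!
# Joshi, *Arithmetic Teichmüller Spaces IV: proof of the abc-conjecture* (arXiv:2403.10430v2) §2.1–§2.6 —
# the CONJECTURES as statements (abc, Arithmetic Szpiro, Vojta's Height Inequality, strong abc), typed

Record file of the abc-iut cell, branch E «type Joshi's construction, test vs S» (rung LADDER-ABC:A2.E; seat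
abc-iut-E-t24, slot T-24, plan/E/OBJECTS.tsv row O-051; JOSHI-DAG nodes J4:Conj2.1.1 … J4:Prop2.6.2; companion file
`ATS4MainTheorem.lean` for §2.7–§3: Thm 2.7.1, 2.8.1, 2.10.1, 3.3.1). **No side is taken** on [IUTchIII] Cor. 3.12, on
Joshi's claims, or on Mochizuki's report on them; the source is an unrefereed arXiv preprint («Preliminary version for
comments», v2, 80 pp.; render `HOME/lit/renders/Joshi-arxiv-2403.10430/`, «p.N l.M» = line M of page file pNNNN.txt).
TYPED ≠ PROVED ≠ ENDORSED; NO abc claim: the four conjectures of §2 are STATED by the source and typed here as named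
`Prop`s, never asserted; what IS proved are only the equivalences / implications AMONG STATEMENTS that are
definitional or classical and already kernel-checked in the tree ([GenEll] vocabulary of
`Literature.NumberTheory.DiophantineGeometry.GenEll*`, `Literature.NumberTheory.EllipticCurves.Szpiro`, the summit
statement `ABC`).

## Contents (node ↦ declaration; «our side» decls are IMPORTED BY NAME, never restated)

* **J4:Conj2.1.1** (p.30 l.8–17) the abc-conjecture in Joshi's `ℤ`-form (primitive integer triples `a + b = c`,
  `max{|a|,|b|,|c|} ≤ C(ε)·∏_{p∣abc} p^{1+ε}`): `AbcConjecture`; **PROVED** `abcConjecture_iff_ABC : AbcConjecture ↔ ABC`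
  (the summit statement `Summits/ABC/ABC/Statement.lean`: coprime positive naturals, `c < C·rad(abc)^{1+ε}`).
  Rmk. 2.1.2 (p.30 l.18–24; Stewart–Tijdeman 1986: the exponent of `N = rad(abc)` cannot be weakened) is held in the
  tree as the barrier `Literature.Barriers.ABC.EpsilonCannotBeDropped`; not restated.
* **J4:Conj2.2.1** (p.30 l.29–32) the Arithmetic Szpiro Conjecture over `ℚ`: `ArithmeticSzpiroConjecture`; **PROVED**
  `arithmeticSzpiroConjecture_iff : … ↔ Literature.NumberTheory.EllipticCurves.SzpiroConjecture`.
* **J4:§2.3** (p.31 l.10–19) bounded discrepancy classes `f ≈ g`, `f ≲ g`: these ARE the tree's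
  `GenEll.BDEquiv` / `GenEll.BDLe` ([GenEll] Def. 1.2 (ii) with the sign correction of [IUTchIV] Rmk. 2.3.1 (ii), which
  Joshi also adopts, p.31 l.15–18); «≈ is an equivalence relation» is `GenEll.BDEquiv.refl/symm/trans` there. Not
  restated.
* **J4:§2.4** (p.31 l.20–40) `log-diff_X`, `log-con_D` for a general `(X, D)/L`: the tree has heights, log-different and
  log-conductor ONLY for `(ℙ¹_ℚ, [0]+[1]+[∞])` (`GenEll.NFPoint.ht/logDiff/logCond`, `GenEll.UPle`); for a general curve
  they are the fields of the INTERIM CARRIER `CurveHeightDatum` (plan/E/ASSIGNMENTS.md §0.3; TODO(general form)), whose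
  one concrete instance `CurveHeightDatum.tripod` is assembled from the tree's decls.
* **J4:Conj2.5.1** (p.32 l.8–14) Vojta's Height Inequality for the curve datum `𝔛`: `CurveHeightDatum.VojtaHeightInequality`;
  **J4:Conj2.6.1** (p.32 l.18–22) the strong abc-conjecture := `∀ d ≥ 1, GenEll.VojtaP1Deg d`: `StrongAbcConjecture`;
  **PROVED** `vojtaHeightInequality_tripod_iff : tripod.VojtaHeightInequality ↔ StrongAbcConjecture`.
* **J4:Prop2.6.2** (p.32 l.23–25) strong abc ⟹ abc («Taking d = 1»): **PROVED** `abcConjecture_of_strongAbcConjecture`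
  (through the tree's abc dictionary `GenEll.abc_of_vojtaP1Deg`).

Faithfulness flags for the referee lanes: docstring of `AbcConjecture` (triples with `abc = 0`), of
`ArithmeticSzpiroConjecture` (reading of `≪ C(ε)·` and of `Δ_E`), of `CurveHeightDatum` (general curves = signature only);
plan/E/t24/INVENTORY.tsv. [cite: Joshi2024ATS4] (unrefereed preprint, claim status disputed); [cite: MochizukiGenEll2010];
standard axioms only.
-/

noncomputable section

open Literature.NumberTheory.DiophantineGeometry Literature.NumberTheory.DiophantineGeometry.GenEll
open Literature.NumberTheory.EllipticCurves

namespace Summit.ABC.IUTFork.Joshi.ATS4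

universe u

/-! ## §2.1 The abc-conjecture (J4:Conj2.1.1, p.30 l.4–24) -/

/-- The right-hand side of [J-IV] Conj. 2.1.1: `∏_{p ∣ a·b·c} p^{1+ε}`, «where the product is over all the prime number p
dividing `a·b·c`» (p.30 l.13–17), computed on `|abc| ∈ ℕ` (`Nat.primeFactors`; for `abc = 0` Lean's `Nat.primeFactors 0 = ∅`
makes this `1`, see `AbcConjecture`). Equals `rad(abc)^{1+ε}` (`radPow_eq`; Rmk. 2.1.2 p.30 l.18: «N = rad(abc) = ∏_{p∣abc} p»).
[cite: Joshi2024ATS4, Conj 2.1.1 p.30 l.13–17] -/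
def radPow (a b c : ℤ) (ε : ℝ) : ℝ :=
  ∏ p ∈ (a * b * c).natAbs.primeFactors, (p : ℝ) ^ (1 + ε)

/-- `∏_{p ∣ abc} p^{1+ε} = rad(abc)^{1+ε}` with `rad` = Mathlib's `UniqueFactorizationMonoid.radical` on `ℕ` applied to
`|abc|` (Rmk. 2.1.2: «N = rad(abc) = ∏_{p∣abc} p»). [cite: Joshi2024ATS4, Rmk 2.1.2 p.30 l.18–19] -/
theorem radPow_eq (a b c : ℤ) (ε : ℝ) :
    radPow a b c ε = ((UniqueFactorizationMonoid.radical (a * b * c).natAbs : ℕ) : ℝ) ^ (1 + ε) := by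
  rw [radPow, Nat.radical_eq_prod_primeFactors, Nat.cast_prod,
    Real.finsetProd_rpow _ (fun p : ℕ => (p : ℝ)) (fun i _ => by positivity) (1 + ε)]

/-- `∏_{p ∣ abc} p^{1+ε}` is positive. [cite: Joshi2024ATS4, Conj 2.1.1 p.30 l.13–17] -/
theorem radPow_pos (a b c : ℤ) (ε : ℝ) : 0 < radPow a b c ε := by
  rw [radPow_eq]
  exact Real.rpow_pos_of_pos (by exact_mod_cast Nat.radical_pos _) _

/-- **[J-IV] Conjecture 2.1.1 (the abc-conjecture), Joshi's `ℤ`-form, verbatim** (p.30 l.8–17): «For each `ε > 0`, there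
exists an absolute constant `C(ε) > 0`, such that for all primitive triples of `a, b, c` integers (i.e. triples of integers
with `gcd(a, b, c) = 1`) satisfying `a + b = c`, one has `max{|a|, |b|, |c|} ≤ C(ε)·∏_{p∣a·b·c} p^{1+ε}` where the product is
over all the prime number `p` dividing `a·b·c`.» `gcd(a,b,c)` is `Int.gcd (Int.gcd a b) c`. READING NOTE (degenerate
triples): the six primitive triples with `abc = 0` — `(±1, 0, ±1)`, `(0, ±1, ±1)`, `(±1, ∓1, 0)` — are not excluded by the
printed sentence, for which the product «over all primes dividing 0» is not meaningful; with Lean's empty product they read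
`1 ≤ C(ε)`, which is immaterial (`abcConjecture_iff_ABC`). A conjecture STATED (not asserted) by the source; its relation
to the summit statement `ABC` is PROVED below. [cite: Joshi2024ATS4, Conj 2.1.1 p.30 l.8–17] -/
def AbcConjecture : Prop :=
  ∀ ε : ℝ, 0 < ε → ∃ C : ℝ, 0 < C ∧
    ∀ a b c : ℤ, Int.gcd (Int.gcd a b) c = 1 → a + b = c →
      ((max (max |a| |b|) |c| : ℤ) : ℝ) ≤ C * radPow a b c ε

/-- For a primitive triple (`gcd(a,b,c) = 1`) with `a + b = c`, already `gcd(a, b) = 1` (a common divisor of `a, b` divides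
`c`). [cite: Joshi2024ATS4, Conj 2.1.1 p.30 l.8–11] -/
theorem gcd_eq_one_of_primitive {a b c : ℤ} (hg : Int.gcd (Int.gcd a b) c = 1) (hs : a + b = c) :
    Int.gcd a b = 1 := by
  have ha : (Int.gcd a b : ℤ) ∣ a := Int.gcd_dvd_left _ _
  have hb : (Int.gcd a b : ℤ) ∣ b := Int.gcd_dvd_right _ _
  have hc : (Int.gcd a b : ℤ) ∣ c := hs ▸ dvd_add ha hb
  have h1 : (Int.gcd a b : ℤ) ∣ (Int.gcd (Int.gcd a b : ℤ) c : ℤ) := Int.dvd_coe_gcd dvd_rfl hc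
  rw [hg] at h1
  have h2 : Int.gcd a b ∣ 1 := by exact_mod_cast h1
  exact Nat.dvd_one.mp h2

/-- In a primitive triple with `a + b = c`, an integer dividing all three entries is `±1`.
[cite: Joshi2024ATS4, Conj 2.1.1 p.30 l.8–11] -/
theorem natAbs_eq_one_of_dvd_primitive {a b c k : ℤ} (hg : Int.gcd (Int.gcd a b) c = 1)
    (ha : k ∣ a) (hb : k ∣ b) (hc : k ∣ c) : k.natAbs = 1 := by
  have h1 : k ∣ (Int.gcd a b : ℤ) := Int.dvd_coe_gcd ha hb
  have h2 : k ∣ (Int.gcd (Int.gcd a b : ℤ) c : ℤ) := Int.dvd_coe_gcd h1 hc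
  rw [hg] at h2
  exact Int.isUnit_iff_natAbs_eq.mp (isUnit_of_dvd_one (by exact_mod_cast h2))

/-- The degenerate primitive triples (`abc = 0`, `a + b = c`, `gcd(a,b,c) = 1`) have `max{|a|,|b|,|c|} ≤ 1`.
[cite: Joshi2024ATS4, Conj 2.1.1 p.30 l.8–17] -/
theorem max_abs_le_one_of_zero {a b c : ℤ} (hg : Int.gcd (Int.gcd a b) c = 1) (hs : a + b = c)
    (h0 : a * b * c = 0) : max (max |a| |b|) |c| ≤ 1 := by
  have key : ∀ {k : ℤ}, k ∣ a → k ∣ b → k ∣ c → |k| = 1 := fun ha hb hc => by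
    rw [Int.abs_eq_natAbs, natAbs_eq_one_of_dvd_primitive hg ha hb hc, Nat.cast_one]
  rcases mul_eq_zero.mp h0 with hab | hc
  · rcases mul_eq_zero.mp hab with ha | hb
    · -- `a = 0`, `b = c`
      subst ha
      have hbc : b = c := by simpa using hs
      subst hbc
      have hb1 : |b| = 1 := key (dvd_zero _) dvd_rfl dvd_rfl
      simp [hb1]
    · -- `b = 0`, `a = c`
      subst hb
      have hac : a = c := by simpa using hs
      subst hac
      have ha1 : |a| = 1 := key dvd_rfl (dvd_zero _) dvd_rfl
      simp [ha1]
  · -- `c = 0`, `b = -a`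
    subst hc
    have hba : b = -a := by linear_combination hs
    subst hba
    have ha1 : |a| = 1 := key dvd_rfl (dvd_neg.mpr dvd_rfl) (dvd_zero _)
    simp [ha1]

/-- **Joshi's `ℤ`-form of the abc-conjecture (Conj. 2.1.1) is equivalent to the summit statement `ABC`** (Masser–Oesterlé
over coprime positive naturals `a + b = c`, `c < C·rad(abc)^{1+ε}`, `Summits/ABC/ABC/Statement.lean`). PROVED: «⟸» rearranges
signs through the tree's `abc_int_of_abcLe` (Bombieri–Gubler 12.2.2–12.2.3) and disposes of the degenerate triples with
`C ≥ 1`; «⟹» specialises to `(a, b, c) ∈ ℕ³` and trades `≤ C` for `< C + 1`. An equivalence of STATEMENTS; nothing is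
asserted about either side. [cite: Joshi2024ATS4, Conj 2.1.1 p.30 l.8–17] -/
theorem abcConjecture_iff_ABC : AbcConjecture ↔ ABC := by
  constructor
  · intro h ε hε
    obtain ⟨C, hC, H⟩ := h ε hε
    refine ⟨C + 1, by linarith, fun a b c ht => ?_⟩
    obtain ⟨_, _, hsum, hcop⟩ := ht
    have hab : Int.gcd (a : ℤ) (b : ℤ) = 1 := by
      rw [Int.gcd_natCast_natCast]; exact Nat.Coprime.gcd_eq_one hcop
    have hg : Int.gcd ((Int.gcd (a : ℤ) (b : ℤ) : ℕ) : ℤ) (c : ℤ) = 1 := by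
      rw [hab]; simp
    have hs : (a : ℤ) + b = c := by exact_mod_cast hsum
    have hmax := H a b c hg hs
    have hrad : radPow a b c ε = ((rad a b c : ℕ) : ℝ) ^ (1 + ε) := by
      have hn : ((a : ℤ) * (b : ℤ) * (c : ℤ)).natAbs = a * b * c := by
        rw [show ((a : ℤ) * (b : ℤ) * (c : ℤ)) = ((a * b * c : ℕ) : ℤ) by push_cast; ring]
        exact Int.natAbs_natCast _
      rw [radPow_eq, rad_def, hn]
    have hcle : (c : ℝ) ≤ ((max (max |(a : ℤ)| |(b : ℤ)|) |(c : ℤ)| : ℤ) : ℝ) := by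
      have : ((c : ℤ)) ≤ max (max |(a : ℤ)| |(b : ℤ)|) |(c : ℤ)| :=
        (le_abs_self (c : ℤ)).trans (le_max_right _ _)
      exact_mod_cast this
    have hR : 0 < ((rad a b c : ℕ) : ℝ) ^ (1 + ε) := by rw [← hrad]; exact radPow_pos _ _ _ _
    calc (c : ℝ) ≤ C * radPow a b c ε := hcle.trans hmax
      _ = C * ((rad a b c : ℕ) : ℝ) ^ (1 + ε) := by rw [hrad]
      _ < (C + 1) * ((rad a b c : ℕ) : ℝ) ^ (1 + ε) := by nlinarith
  · intro h ε hε
    have habc : ∀ ε : ℝ, 0 < ε → ∃ C : ℝ, ∀ a b c : ℕ, IsABCTriple a b c →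
        (c : ℝ) ≤ C * ((rad a b c : ℕ) : ℝ) ^ (1 + ε) := fun ε' hε' => by
      obtain ⟨C, -, hC⟩ := h ε' hε'
      exact ⟨C, fun a b c ht => (hC a b c ht).le⟩
    obtain ⟨C, hC1, H⟩ := abc_int_of_abcLe habc hε
    refine ⟨C, by linarith, fun a b c hg hs => ?_⟩
    by_cases h0 : a * b * c = 0
    · -- degenerate triples: the product is empty, `max ≤ 1 ≤ C`
      have hprod : radPow a b c ε = 1 := by
        rw [radPow, h0]; simp
      have hm : ((max (max |a| |b|) |c| : ℤ) : ℝ) ≤ 1 := by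
        exact_mod_cast max_abs_le_one_of_zero hg hs h0
      rw [hprod, mul_one]
      exact hm.trans hC1
    · have ha : a ≠ 0 := fun h => h0 (by simp [h])
      have hb : b ≠ 0 := fun h => h0 (by simp [h])
      have hc : c ≠ 0 := fun h => h0 (by simp [h])
      have hcop : IsCoprime a b := Int.isCoprime_iff_gcd_eq_one.mpr (gcd_eq_one_of_primitive hg hs)
      obtain ⟨h1, h2, h3⟩ := H a b (-c) ha hb (neg_ne_zero.mpr hc) hcop (by rw [← hs]; ring)
      have hnat : (a * b * -c).natAbs = (a * b * c).natAbs := by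
        rw [mul_neg, Int.natAbs_neg]
      rw [Int.natAbs_neg] at h3
      rw [hnat, ← radPow_eq, Nat.cast_natAbs, Int.cast_abs] at h1 h2 h3
      push_cast
      exact max_le (max_le h1 h2) h3

/-! ## §2.2 Arithmetic Szpiro Conjecture (J4:Conj2.2.1, p.30 l.25–36)

Rmk. 2.2.2 (p.30 l.33–36, Masser 1990: the exponent `6` is optimal, `|Δ_E| ≥ N_E^6·exp((24−δ)(log N_E)^{1/2}/log log N_E)`
infinitely often) is held in the tree as the barrier `Literature.Barriers.ABC.SzpiroEpsilonCannotBeDropped` (with `_holds`);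
Rmk. 2.1.2 (Stewart–Tijdeman 1986) is likewise the barrier `Literature.Barriers.ABC.EpsilonCannotBeDropped`. Rmk. 2.2.3 (geometric
Szpiro: [Szpiro 1990], [Kim 1997], [Amorós et al. 2000], [Zhang 2001], [Beauville 2002]; [Mochizuki 2016]; [Joshi 2023a §10]) is expository. -/

/-- **[J-IV] Conjecture 2.2.1 (the Arithmetic Szpiro Conjecture), verbatim** (p.30 l.29–32): «Let `0 < ε ∈ ℝ`, then there
exists an absolute constant `C(ε) > 0` such that for all elliptic curves `E/ℚ`, one has `|Δ_E|_ℝ ≪ C(ε)·N_E^{(6+ε)}`», with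
«`Δ_E` for its discriminant and `N_E` for its conductor [Silverman, 1985]» (p.30 l.26–28). READING: `≪ C(ε)·` is read `≤ C(ε)·`
(the displayed constant absorbs the implied one); `Δ_E` = the MINIMAL discriminant, `N_E` = the conductor, i.e. the tree's
`WeierstrassCurve.minimalDiscriminantNorm ℤ` / `conductorNorm ℤ` exactly as in
`Literature.NumberTheory.EllipticCurves.SzpiroConjecture` (Silverman AEC Conj. VIII.11.1), from which it differs only by the
printed `C(ε) > 0` (`arithmeticSzpiroConjecture_iff`). Stated, not asserted. [cite: Joshi2024ATS4, Conj 2.2.1 p.30 l.29–32] -/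
def ArithmeticSzpiroConjecture : Prop :=
  ∀ ε : ℝ, 0 < ε → ∃ C : ℝ, 0 < C ∧ ∀ (W : WeierstrassCurve ℚ) [W.IsElliptic],
    (W.minimalDiscriminantNorm ℤ : ℝ) ≤ C * (W.conductorNorm ℤ : ℝ) ^ (6 + ε)

/-- Joshi's Conj. 2.2.1 is the tree's `SzpiroConjecture` (the sign condition `C(ε) > 0` is free: replace `C` by
`max C 1`). PROVED; an equivalence of statements. [cite: Joshi2024ATS4, Conj 2.2.1 p.30 l.29–32] -/
theorem arithmeticSzpiroConjecture_iff : ArithmeticSzpiroConjecture ↔ SzpiroConjecture := by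
  constructor
  · intro h ε hε
    obtain ⟨C, -, hC⟩ := h ε hε
    exact ⟨C, fun W _ => hC W⟩
  · intro h ε hε
    obtain ⟨C, hC⟩ := h ε hε
    refine ⟨max C 1, by positivity, fun W _ => (hC W).trans ?_⟩
    exact mul_le_mul_of_nonneg_right (le_max_left _ _) (Real.rpow_nonneg (Nat.cast_nonneg _) _)

/-! ## §2.3–§2.5 Bounded discrepancy, `log-diff`, `log-con`, Vojta's Height Inequality (p.31 l.10 – p.32 l.14)

§2.3 (p.31 l.10–19): «`f ≈ g` if `|f − g| : X → ℝ` is a bounded function … `f ≲ g` if `f(x) − g(x) ≤ C` for some constant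
`C`» — these are `GenEll.BDEquiv X f g` and `GenEll.BDLe X f g` of the tree (same sign convention: Joshi p.31 l.15–18 points at
the misprint of [Mochizuki, 2010, Def. 1.2 (ii)] corrected in [Mochizuki, 2021d, Rmk. 2.3.1 (ii)], which `GenEllBDClasses.lean`
implements); «≈ is an equivalence relation» = `GenEll.BDEquiv.refl/symm/trans`. Used below BY NAME. -/

/-- **INTERIM CARRIER for [J-IV] §2.4–§2.5** (plan/E/ASSIGNMENTS.md §0.3): the data through which Conj. 2.5.1 / Thm. 2.10.1 read
a pair `(X, D)/L` — «a geometrically connected, smooth, projective curve over `L` and `D ⊂ X` a reduced divisor such that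
`U = X − D` is a (punctured) hyperbolic curve over `L`» (p.32 l.9–11): its points `X(Q̄)` (each `P` with minimal field of
definition `L(P)`, p.31 l.23–24), the degree `[L(P) : L]` filtering `U(Q̄)_{≤d}` («the subset of points of degree `≤ d`», p.32
l.5–6), the subset `U(Q̄) = (X − D)(Q̄)`, and the three real-valued functions `ht_{ω_X(D)}` (height for the sheaf of
differentials twisted by `D`, p.32 l.2), `log-diff_X(P) = (1/[L(P):L])·deg(𝔡_{L(P)/L})` («the normalized arithmetic degree of
the arithmetic divisor given by the different», p.31 l.25–31) and `log-con_D(P) = (1/[L(P):L])·deg((ι_P^* D)_red)` («the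
normalized arithmetic degree of the reduced divisor», p.31 l.32–39). SIGNATURE ONLY: the tree has no height machine for
general curves (TODO(general form); [GenEll] Def. 1.1–1.5), its one genuine instance being `tripod` below; universe `u` so
that the `Type 1`-valued tripod points fit. [cite: Joshi2024ATS4, §2.4 p.31 l.20–40] -/
structure CurveHeightDatum : Type (u + 1) where
  /-- the points `X(Q̄)` (presented over their minimal fields of definition `L(P)`) -/
  Pt : Type u
  /-- the degree `[L(P) : L]` of the minimal field of definition -/
  deg : Pt → ℕ
  /-- the points of `U = X − D` -/
  U : Set Pt
  /-- the height `ht_{ω_X(D)}` -/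
  ht : Pt → ℝ
  /-- the log-different `log-diff_X` (§2.4, p.31 l.25–31) -/
  logDiff : Pt → ℝ
  /-- the log-conductor `log-con_D` (§2.4, p.31 l.32–39) -/
  logCon : Pt → ℝ

namespace CurveHeightDatum

variable (𝔛 : CurveHeightDatum.{u})

/-- `U(Q̄)_{≤d} = (X − D)(Q̄)_{≤d}`: «the subset of points of degree `≤ d`» of `U(Q̄)` (p.32 l.5–6).
[cite: Joshi2024ATS4, §2.5 p.32 l.5–6] -/
def pointsLe (d : ℕ) : Set 𝔛.Pt := {P | P ∈ 𝔛.U ∧ 𝔛.deg P ≤ d}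

/-- The displayed inequality of Conj. 2.5.1 / Thm. 2.10.1 at degree `d` and `ε`: «`ht_{ω_X(D)} ≲ (1 + ε)(log-diff_X + log-con_D)`
holds on `U(Q̄)_{≤d}`» (p.32 l.13–14; `≲` = `GenEll.BDLe`, §2.3). [cite: Joshi2024ATS4, Conj 2.5.1 p.32 l.13–14] -/
def VojtaInequality (d : ℕ) (ε : ℝ) : Prop :=
  BDLe (𝔛.pointsLe d) 𝔛.ht (fun P => (1 + ε) * (𝔛.logDiff P + 𝔛.logCon P))

/-- **[J-IV] Conjecture 2.5.1 (Vojta's Height Inequality for curves: Mochizuki's formulation) FOR THE CURVE DATUM `𝔛`**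
(p.32 l.8–14): «Let `L` be a number field. Let `(X, D)/L` be a pair … such that `U = X − D` is a (punctured) hyperbolic curve
over `L`. Let `d ≥ 1` be an integer. Then for every `ε > 0`, the following inequality `ht_{ω_X(D)} ≲ (1 + ε)(log-diff_X +
log-con_D)` holds on `U(Q̄)_{≤d} = (X − D)(Q̄)_{≤d}`.» The conjecture proper is this predicate for EVERY genuine hyperbolic
`(X, D)/L` (a family the tree cannot construct: see `MainTheorem`); for `(ℙ¹_ℚ, {0,1,∞})` it is `StrongAbcConjecture`
(`vojtaHeightInequality_tripod_iff`). Stated, not asserted. [cite: Joshi2024ATS4, Conj 2.5.1 p.32 l.8–14] -/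
def VojtaHeightInequality : Prop :=
  ∀ d : ℕ, 0 < d → ∀ ε : ℝ, 0 < ε → 𝔛.VojtaInequality d ε

/-- A Vojta inequality at degree `d` restricts to every subset of `U(Q̄)_{≤d}` (the «immediate» direction of Thm. 2.8.1).
[cite: Joshi2024ATS4, Thm 2.8.1 p.33 l.9–13] -/
theorem VojtaInequality.mono {𝔛 : CurveHeightDatum.{u}} {d : ℕ} {ε : ℝ} (h : 𝔛.VojtaInequality d ε)
    {S : Set 𝔛.Pt} (hS : S ⊆ 𝔛.pointsLe d) :
    BDLe S 𝔛.ht (fun P => (1 + ε) * (𝔛.logDiff P + 𝔛.logCon P)) :=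
  BDLe.mono h hS

/-- **«The fundamental hyperbolic tripod over `ℚ`»** `(X, D) = (ℙ¹, {0, 1, ∞})` (Conj. 2.6.1, p.32 l.18–19) as a curve datum,
assembled from the tree's [GenEll] vocabulary BY NAME: points `GenEll.NFPoint` (a number field `F` and `λ ∈ F`), degree
`[F : ℚ]`, `U_P(Q̄)` = `GenEll.UP` (`λ ≠ 0, 1`, `F = ℚ(λ)` minimal), `ht_{ω_P(C)}` = `NFPoint.ht`, `log-diff` = `NFPoint.logDiff`,
`log-con` = `NFPoint.logCond` (here `L = ℚ`, so Joshi's `[L(P):L]`, `𝔡_{L(P)/L}` are `[F:ℚ]`, `𝔡_{F/ℤ}`).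
[cite: Joshi2024ATS4, Conj 2.6.1 p.32 l.18–19] -/
def tripod : CurveHeightDatum.{1} where
  Pt := NFPoint
  deg := NFPoint.degree
  U := UP
  ht := NFPoint.ht
  logDiff := NFPoint.logDiff
  logCon := NFPoint.logCond

/-- `U_tpd(Q̄)_{≤d}` of the tripod is the tree's `GenEll.UPle d`. [cite: Joshi2024ATS4, Conj 2.6.1 p.32 l.22] -/
theorem tripod_pointsLe (d : ℕ) : tripod.pointsLe d = UPle d := rfl

/-- The tripod's Vojta inequality at `(d, ε)` is the tree's `GenEll.VojtaIneq Set.univ d ε` ([GenEll] Thm. 2.1 (i)|_{ℙ¹}).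
[cite: Joshi2024ATS4, Conj 2.6.1 p.32 l.18–22] -/
theorem tripod_vojtaInequality_iff (d : ℕ) (ε : ℝ) : tripod.VojtaInequality d ε ↔ VojtaIneq Set.univ d ε := by
  unfold VojtaInequality VojtaIneq
  rw [Set.univ_inter]
  exact Iff.rfl

end CurveHeightDatum

/-! ## §2.6 The strong abc-conjecture (J4:Conj2.6.1, J4:Prop2.6.2; p.32 l.15–25) -/

/-- **[J-IV] Conjecture 2.6.1 (the strong abc-conjecture: Mochizuki's formulation)** (p.32 l.18–22; [Bombieri–Gubler Conj.
14.4.12]): «Let `(X, D) = (ℙ¹, {0, 1, ∞})` be the fundamental hyperbolic tripod over `ℚ`. Let `d ≥ 1` be an integer. Then for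
every `ε > 0` the following inequality `ht_{ω_{ℙ¹}(D)} ≲ (1 + ε)(log-diff_{ℙ¹} + log-con_D)` holds on `U_tpd(Q̄)_{≤d} =
(ℙ¹ − {0, 1, ∞})(Q̄)_{≤d}`.» Typed BY NAME over the tree: for every `d ≥ 1`, `GenEll.VojtaP1Deg d` ([GenEll] Thm. 2.1 (i) for
`(ℙ¹_ℚ, [0]+[1]+[∞])`; = the `ℙ¹` case of [IUTchIV] Cor. 2.3). Stated, not asserted (open).
[cite: Joshi2024ATS4, Conj 2.6.1 p.32 l.18–22] -/
def StrongAbcConjecture : Prop :=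
  ∀ d : ℕ, 0 < d → VojtaP1Deg d

/-- Conj. 2.5.1 for the tripod datum IS Conj. 2.6.1 (definitional, through `GenEll.VojtaIneq`). PROVED.
[cite: Joshi2024ATS4, Conj 2.6.1 p.32 l.18–22] -/
theorem vojtaHeightInequality_tripod_iff :
    CurveHeightDatum.tripod.VojtaHeightInequality ↔ StrongAbcConjecture := by
  unfold CurveHeightDatum.VojtaHeightInequality StrongAbcConjecture VojtaP1Deg
  simp only [CurveHeightDatum.tripod_vojtaInequality_iff]

/-- **[J-IV] Proposition 2.6.2** (p.32 l.23–25): «The strong abc-conjecture (Conjecture 2.6.1) implies the abc-conjecture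
(Conjecture 2.1.1). Proof. Taking `d = 1` one obtains the assertion.» PROVED (kernel): the `d = 1` dictionary for `ℚ`-points
of `ℙ¹ ∖ {0,1,∞}` is the tree's `GenEll.abc_of_vojtaP1Deg` (`ht = log c`, `log-diff = 0`, `log-con = log rad(abc)`), then
`abcConjecture_iff_ABC`. [cite: Joshi2024ATS4, Prop 2.6.2 p.32 l.23–25] -/
theorem abcConjecture_of_strongAbcConjecture (h : StrongAbcConjecture) : AbcConjecture :=
  abcConjecture_iff_ABC.mpr (ABC_iff.mpr (abc_of_vojtaP1Deg h))

/-- Prop. 2.6.2 with the summit statement as conclusion: `StrongAbcConjecture → ABC`. PROVED (an implication between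
statements; nothing asserted). [cite: Joshi2024ATS4, Prop 2.6.2 p.32 l.23–25] -/
theorem ABC_of_strongAbcConjecture (h : StrongAbcConjecture) : ABC :=
  ABC_iff.mpr (abc_of_vojtaP1Deg h)

end Summit.ABC.IUTFork.Joshi.ATS4

end
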